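import Literature.NumberTheory.NumberFields.ClassGroupMinusPartOddCharacters
import Literature.NumberTheory.NumberFields.CMFieldRelativeClassNumberDivisibility
import HarnessLib

/-!
# `H`-invariant characters of `Cl(K)` are the characters of `Cl(K^H)` when `#H` is invertible on the values:
# `Hom(Cl(K), V)^H = Hom(Cl(K^H), V) ∘ N_{K/K^H}` (Neukirch III (1.6) (ii) + (iv); Washington §10.1)

Topic `NumberTheory/NumberFields` (namespace = path).  THEOREM-ONLY file (no definition, no named fact, no `sorry`),
written by the prover seat `bsd-potss-k8t-c4` g25 (cell `bsd-potss`; `--supports` stmt-BirchSwinnertonDyer-19982, the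
U₀ node `TameUpperDefectRankZero` of route K8-t′ `KatoDescentTamePotSupersingular`; closes nothing; BSD is proved for no
curve here).  Companion of `ClassGroupPTorsionFixedFieldDescent.lean` (same seat; the `p`-torsion count
`#Cl(K)[p]^H = #Cl(K^H)[p]`), in the CHARACTER currency of the tree's door-L6 theorems
(`EquivariantIwasawaLemma.equivariantHom_classGroup_eq_zero_layer_compositum_tower_of_totallyRamified`:
«every equivariant additive `Cl(𝓞_{L_n}) → V` vanishes»).

Setting: `K/F` a finite Galois extension of number fields, `H ≤ Gal(K/F)` with fixed field `K^H`, `V` an additive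
commutative group killed by `n` with `gcd(n, #H) = 1`, `N = N_{K/K^H} : Cl(K) → Cl(K^H)` and `i = i_{K/K^H}` the norm
and extension maps of the tree (`classGroupNorm`, `classGroupExtend`).

* `classGroupNorm_fixedField_mulEquiv_intAut` — `N(h • c) = N(c)` for `h ∈ H` (`h|_{K^H} = 1`; tree
  `classGroupNorm_mulEquiv_intAut`);
* `comp_classGroupNorm_fixed` — every `μ ∘ N` (`μ : Cl(K^H) → V` additive) is `H`-invariant;
* `comp_classGroupNorm_injective` — `μ ↦ μ ∘ N` is injective: `N(i d) = d^{[K:K^H]} = d^{#H}` (Neukirch III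
  (1.6) (ii), tree `classGroupNorm_classGroupExtend`) and `#H` is invertible on `V`;
* `exists_eq_comp_classGroupNorm_of_fixed` — every `H`-invariant additive `ν : Cl(K) → V` is `μ ∘ N` with
  `μ = a·(ν ∘ i)`, `a·#H ≡ 1 (mod n)`: `ν(i(N c)) = ν(∏_{h ∈ H} h • c) = #H · ν(c)` (Neukirch III (1.6) (iv), tree
  `NormRelation.classGroupExtend_classGroupNorm_fixedField_eq_prod`);
* **`natCard_fixed_addMonoidHom_classGroup_eq`** — hence
  `#{ν : Cl(K) → V additive, H-invariant} = #{μ : Cl(K^H) → V additive}`.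

With `V = ℤ/p`, `p ∤ #H`: the `H`-invariant `𝔽_p`-characters of `Cl(K)` are exactly as many as the `𝔽_p`-characters of
`Cl(K^H)`, i.e. `dim_{𝔽_p} (Cl(K)/p)_H = rank_p Cl(K^H)` — the reading the cell needs to turn the vanishing / counting of
EQUIVARIANT characters of `Cl(ℚ(E[p])·ℚ_n)` (door L6 and its counting form) into the `p`-RANK of the class group of a
non-Galois leaf `ℚ(P)·ℚ_n = (ℚ(E[p])·ℚ_n)^H` (isotypic bookkeeping of the μ-roads of the K8-t′ / K9 census).

## References

* J. Neukirch, *Algebraic Number Theory*, Grundlehren 322 (1999), Ch. III §1 Prop. (1.6) (ii), (iv). [NeukirchANT1999]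
* L. C. Washington, *Introduction to Cyclotomic Fields*, 2nd ed., GTM 83 (1997), §10.1 (before Thm. 10.1). [Washington1997]
-/

noncomputable section

open NumberField IntermediateField

namespace Literature.NumberTheory.NumberFields

variable (F K : Type) [Field F] [NumberField F] [Field K] [NumberField K] [Algebra F K]

/-- **The norm to a fixed field is `H`-invariant: `N_{K/K^H}(h • c) = N_{K/K^H}(c)` for `h ∈ H`** (`h` restricts to
the identity of `K^H`; tree `classGroupNorm_mulEquiv_intAut`). [cite: NeukirchANT1999, Ch. III §1 Prop. (1.6) (iv)] -/
theorem classGroupNorm_fixedField_mulEquiv_intAut (H : Subgroup (K ≃ₐ[F] K)) (h : K ≃ₐ[F] K) (hh : h ∈ H)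
    (c : ClassGroup (𝓞 K)) :
    classGroupNorm ↥(fixedField H) K (ClassGroup.mulEquiv (AmbiguousClass.intAut h) c) =
      classGroupNorm ↥(fixedField H) K c := by
  have hσ : ∀ x : ↥(fixedField H), h (algebraMap ↥(fixedField H) K x) =
      algebraMap ↥(fixedField H) K ((1 : ↥(fixedField H) ≃ₐ[F] ↥(fixedField H)) x) := by
    intro x
    rw [AlgEquiv.one_apply]
    exact (mem_fixedField_iff H (x : K)).mp x.2 h hh
  have key := classGroupNorm_mulEquiv_intAut ↥(fixedField H) K h (1 : ↥(fixedField H) ≃ₐ[F] ↥(fixedField H)) hσ c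
  rw [AmbiguousClass.mulEquiv_intAut_one, MulEquiv.refl_apply] at key
  exact key

section Descent

variable {V : Type*} [AddCommGroup V]

/-- **`μ ∘ N_{K/K^H}` is `H`-invariant** for every additive `μ : Cl(K^H) → V`.
[cite: NeukirchANT1999, Ch. III §1 Prop. (1.6) (iv)] -/
theorem comp_classGroupNorm_fixed (H : Subgroup (K ≃ₐ[F] K)) (μ : Additive (ClassGroup (𝓞 ↥(fixedField H))) →+ V)
    (h : K ≃ₐ[F] K) (hh : h ∈ H) (c : ClassGroup (𝓞 K)) :
    (μ.comp (classGroupNorm ↥(fixedField H) K).toAdditive)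
        (Additive.ofMul (ClassGroup.mulEquiv (AmbiguousClass.intAut h) c)) =
      (μ.comp (classGroupNorm ↥(fixedField H) K).toAdditive) (Additive.ofMul c) := by
  simp only [AddMonoidHom.coe_comp, Function.comp_apply, MonoidHom.toAdditive_apply_apply, toMul_ofMul,
    classGroupNorm_fixedField_mulEquiv_intAut F K H h hh c]

/-- An element of an additive group killed by two coprime natural numbers is `0`. [folklore] -/
private theorem eq_zero_of_nsmul_eq_zero_of_coprime {a b : ℕ} (hab : a.Coprime b) {x : V} (ha : a • x = 0)
    (hb : b • x = 0) : x = 0 := by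
  have hord : addOrderOf x ∣ 1 := by
    rw [← hab]
    exact Nat.dvd_gcd (addOrderOf_dvd_of_nsmul_eq_zero ha) (addOrderOf_dvd_of_nsmul_eq_zero hb)
  exact AddMonoid.addOrderOf_eq_one_iff.mp (Nat.dvd_one.mp hord)

/-- **`μ ↦ μ ∘ N_{K/K^H}` is injective on additive maps `Cl(K^H) → V` when `gcd(n, #H) = 1` and `n·V = 0`**:
`N(i d) = d^{[K : K^H]} = d^{#H}` (Neukirch III (1.6) (ii), tree `classGroupNorm_classGroupExtend`), so `μ ∘ N = μ' ∘ N`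
gives `#H · (μ − μ')(d) = 0 = n · (μ − μ')(d)`. [cite: NeukirchANT1999, Ch. III §1 Prop. (1.6) (ii)] -/
theorem comp_classGroupNorm_injective [IsGalois F K] (H : Subgroup (K ≃ₐ[F] K)) [Fintype H] {n : ℕ}
    (hV : ∀ v : V, n • v = 0) (hn : n.Coprime (Fintype.card H)) :
    Function.Injective fun μ : Additive (ClassGroup (𝓞 ↥(fixedField H))) →+ V =>
      μ.comp (classGroupNorm ↥(fixedField H) K).toAdditive := by
  classical
  haveI : FiniteDimensional F K := Module.Finite.of_restrictScalars_finite ℚ F K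
  have hdeg : Module.finrank ↥(fixedField H) K = Fintype.card H := by
    rw [finrank_fixedField_eq_card, Nat.card_eq_fintype_card]
  intro μ μ' hμ
  refine AddMonoidHom.ext fun d => ?_
  -- `N (i d) = #H • d` additively
  have hNi : (classGroupNorm ↥(fixedField H) K).toAdditive
      ((classGroupExtend ↥(fixedField H) K).toAdditive d) = Fintype.card H • d := by
    rw [MonoidHom.toAdditive_apply_apply, MonoidHom.toAdditive_apply_apply, toMul_ofMul,
      classGroupNorm_classGroupExtend ↥(fixedField H) K, hdeg, ofMul_pow, ofMul_toMul]
  have h1 := congrArg (fun ν : Additive (ClassGroup (𝓞 K)) →+ V =>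
    ν ((classGroupExtend ↥(fixedField H) K).toAdditive d)) hμ
  simp only [AddMonoidHom.coe_comp, Function.comp_apply] at h1
  rw [hNi, map_nsmul, map_nsmul] at h1
  have hsub : Fintype.card H • (μ d - μ' d) = 0 := by rw [nsmul_sub, h1, sub_self]
  have hnsub : n • (μ d - μ' d) = 0 := by rw [nsmul_sub, hV, hV, sub_zero]
  exact sub_eq_zero.mp (eq_zero_of_nsmul_eq_zero_of_coprime hn hnsub hsub)

/-- **Every `H`-invariant additive `ν : Cl(K) → V` factors through the norm**, `ν = μ ∘ N_{K/K^H}` with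
`μ = a · (ν ∘ i_{K/K^H})`, `a · #H ≡ 1 (mod n)`: indeed `ν(i(N c)) = ν(∏_{h ∈ H} h • c) = Σ_h ν(h • c) = #H · ν(c)`
(Neukirch III (1.6) (iv), tree `NormRelation.classGroupExtend_classGroupNorm_fixedField_eq_prod`), and `#H` is invertible
on `V` (`n · V = 0`, `gcd(n, #H) = 1`). [cite: NeukirchANT1999, Ch. III §1 Prop. (1.6) (iv)] [cite: Washington1997, §10.1] -/
theorem exists_eq_comp_classGroupNorm_of_fixed [IsGalois F K] (H : Subgroup (K ≃ₐ[F] K)) [Fintype H] {n : ℕ}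
    (hV : ∀ v : V, n • v = 0) (hn : n.Coprime (Fintype.card H))
    (ν : Additive (ClassGroup (𝓞 K)) →+ V)
    (hν : ∀ h ∈ H, ∀ c : ClassGroup (𝓞 K),
      ν (Additive.ofMul (ClassGroup.mulEquiv (AmbiguousClass.intAut h) c)) = ν (Additive.ofMul c)) :
    ∃ μ : Additive (ClassGroup (𝓞 ↥(fixedField H))) →+ V,
      ν = μ.comp (classGroupNorm ↥(fixedField H) K).toAdditive := by
  classical
  -- Bézout: `a · #H + b · n = 1`
  obtain ⟨a, b, hab⟩ : ∃ a b : ℤ, a * (Fintype.card H : ℤ) + b * (n : ℤ) = 1 := by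
    have hc : IsCoprime (Fintype.card H : ℤ) (n : ℤ) := Nat.isCoprime_iff_coprime.mpr hn.symm
    obtain ⟨a, b, h⟩ := hc
    exact ⟨a, b, h⟩
  have hinv : ∀ v : V, a • ((Fintype.card H : ℤ) • v) = v := by
    intro v
    have h0 : (b * (n : ℤ)) • v = 0 := by rw [mul_smul, natCast_zsmul, hV, smul_zero]
    calc a • ((Fintype.card H : ℤ) • v) = (a * (Fintype.card H : ℤ)) • v + (b * (n : ℤ)) • v := by
          rw [mul_smul, h0, add_zero]
      _ = v := by rw [← add_smul, hab, one_smul]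
  refine ⟨a • ν.comp (classGroupExtend ↥(fixedField H) K).toAdditive, AddMonoidHom.ext fun c => ?_⟩
  rw [AddMonoidHom.comp_apply, AddMonoidHom.smul_apply, AddMonoidHom.comp_apply,
    MonoidHom.toAdditive_apply_apply, MonoidHom.toAdditive_apply_apply, toMul_ofMul,
    NormRelation.classGroupExtend_classGroupNorm_fixedField_eq_prod F K H (Additive.toMul c), ofMul_prod, map_sum]
  have hterm : ∀ h : H, ν (Additive.ofMul (ClassGroup.mulEquiv (AmbiguousClass.intAut (h : K ≃ₐ[F] K))
      (Additive.toMul c))) = ν c := fun h => by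
    rw [hν h h.2 (Additive.toMul c), ofMul_toMul]
  simp only [hterm, Finset.sum_const, Finset.card_univ]
  rw [← natCast_zsmul, hinv]

/-- **`#{H-invariant additive ν : Cl(K) → V} = #{additive μ : Cl(K^H) → V}`** for `K/F` finite Galois, `H ≤ Gal(K/F)`,
`n · V = 0`, `gcd(n, #H) = 1`: the bijection `μ ↦ μ ∘ N_{K/K^H}` (`comp_classGroupNorm_fixed`,
`comp_classGroupNorm_injective`, `exists_eq_comp_classGroupNorm_of_fixed`).  With `V = ℤ/p`, `p ∤ #H` this reads
`dim_{𝔽_p} (Cl(K)/p)_H = rank_p Cl(K^H)`. [cite: NeukirchANT1999, Ch. III §1 Prop. (1.6) (ii), (iv)] [cite: Washington1997, §10.1] -/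
theorem natCard_fixed_addMonoidHom_classGroup_eq [IsGalois F K] (H : Subgroup (K ≃ₐ[F] K)) [Fintype H] {n : ℕ}
    (hV : ∀ v : V, n • v = 0) (hn : n.Coprime (Fintype.card H)) :
    Nat.card {ν : Additive (ClassGroup (𝓞 K)) →+ V // ∀ h ∈ H, ∀ c : ClassGroup (𝓞 K),
      ν (Additive.ofMul (ClassGroup.mulEquiv (AmbiguousClass.intAut h) c)) = ν (Additive.ofMul c)} =
      Nat.card (Additive (ClassGroup (𝓞 ↥(fixedField H))) →+ V) := by
  classical
  let Φ : (Additive (ClassGroup (𝓞 ↥(fixedField H))) →+ V) →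
      {ν : Additive (ClassGroup (𝓞 K)) →+ V // ∀ h ∈ H, ∀ c : ClassGroup (𝓞 K),
        ν (Additive.ofMul (ClassGroup.mulEquiv (AmbiguousClass.intAut h) c)) = ν (Additive.ofMul c)} := fun μ =>
    ⟨μ.comp (classGroupNorm ↥(fixedField H) K).toAdditive, fun h hh c => comp_classGroupNorm_fixed F K H μ h hh c⟩
  have hΦ : Function.Bijective Φ := by
    constructor
    · intro μ μ' h
      exact comp_classGroupNorm_injective F K H hV hn (congrArg Subtype.val h)
    · rintro ⟨ν, hν⟩
      obtain ⟨μ, hμ⟩ := exists_eq_comp_classGroupNorm_of_fixed F K H hV hn ν hν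
      exact ⟨μ, Subtype.ext hμ.symm⟩
  exact (Nat.card_eq_of_bijective Φ hΦ).symm

end Descent

end Literature.NumberTheory.NumberFields

end
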